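import Literature.MathematicalPhysics.QuantumFieldTheory.Balaban1983to89.Node00.Record13CarriersXPinnedH
import Literature.MathematicalPhysics.QuantumFieldTheory.Balaban1983to89.Node00.Record13CarriersSepCoPH
import Literature.MathematicalPhysics.QuantumFieldTheory.Balaban1983to89.Node00.Record13CarriersXPinnedHCoPR

/-!
# NODE 00 (YM-PLAN Track A) — THE H-PIN AT THE v1.7 `CoPH` KEY: faces of dag-n10-d's H-lift `Stage13HParams.pinX3H` BY NAME, the v1.7 separated-range
# provisos ∕ datum ∕ records along it, and N05's SURVIVING socket under the S-binding at the v1.7 view (`socket05S_toStage5₁₃CoPH_pinX3H_iff`, `Iff.rfl`)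

v1.7 `CoPH` IMAGE (token map T₇, dag-lead WORDS-143 ∕ node00-def-T `KEYMAP-Record13-v1.7.md`: binder `θ : Stage13HParams`, `CoPR ↦ CoPH`, dotted
`Stage13RParams.X ↦ Stage13HParams.X`, SITE-RULE `X F N θ ↦ X F N θ.toStage13Params` for the edition-free θ-level objects) of this seat's v1.6 `Record13CarriersXPinnedHCoPR`
(p532917, which STANDS), itself the image of the `CoP`-reading sections §1b ∕ §2b ∕ §3 of this seat's `Node00/Record13CarriersXPinnedH` (p526413); that file's §1
(`XPinned₁₃H`, the θ-level pin `Stage13Params.pinX3H` and its `rfl` faces) and §2 (the typed sockets at the v1.2 view `toStage5₁₃`) are EDITION-FREE and STAND —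
nothing of them is re-declared.  The H-LIFT `Stage13HParams.pinX3H θ lam8 lam12 lam13 := θ.rebindX F N (XPinned₁₃H F N θ.toStage13Params lam8 lam12 lam13)` is
dag-n10-d's (`Node00/Record13CarriersCoPH` §0, p539476; WORD-RLIFT 2026-08-27, H-level re-issue g11) together with its tuple faces (`pins_toStage13Params`, `pinB13_pinX3_Zh`, `pins_eq_rebindX`,
`pins_admissible_iff`), `pinX3H_guard_iff`, `Provisos₁₃CoPH.pinX3H`, `toStage5₁₃CoPH_pinX3H`, `datumOfRecord₁₃CoPH_pinX3H`, `isRecordOfRecord₁₃CCoPH_pinX3H_of_eq` — all CITED.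

NODE 00 RECORD MODULE (seat `pub-ymgap-dag-n05-d` g7, 2026-08-27; APPEND-ONLY: a NEW importing module; NOTHING in `Record13CarriersXPinnedH` (this seat), `Record13CarriersCoPH ∕
SepCoPH` (dag-n10-d), `Record13CoPH ∕ SepCoPH` (node00-def-T FILE 27 ∕ 28T, p537939 ∕ p539169) or below them is edited — everything BY NAME).

WHY.  The K1⁷ engine (dag-n24-c) and the N10 closers (dag-n10-d) read the H-pin at the v1.7 key; the N05 knits of record (`Thm/BalabanUVNodesN05SubBHKnitUniv(T8Srv)`)
serve the SURVIVING [B8″H] slot `B8LeafOfRecordSubBH θ₃ lam8`, which is exactly the `b8` leaf of the S-binding `upOfRecord₅CS` over the H-pinned v1.7 view (§2b,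
`Iff.rfl`); the S-bound records of this seat (`Record13CarriersXPinnedHSCoPH`, `…HSViewCoPH`) are built on the faces below.

WHAT IS PROVED (kernel bookkeeping, 0 sorry, no new mathematics; never a direct `rfl` AT the pin — every face is an instance of a generic-`X′` face or a θ-level face
read through `toStage13Params`): §0 NOTHING (the single-name faces `Stage13RParams.pinX3H_res_X ∕ _toStage12Params ∕ _histories`, `WOfRecord₁₃_pinX3H_R` of the v1.6
`Record13CarriersXPinnedHCoPR` §0 apply VERBATIM at `θ.toStage13RParams` — the gate's dedup reads their H-instances as restatements —, the θ-level faces of `Record13CarriersXPinnedH` §1 at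
`θ.toStage13Params`; both modules imported); §1b `Stage13HParams.pinX3H_lawsCoPH` (`SLaw₁₃CoPH ∕ TLaw₁₃CoPH`
are `θ`'s), `Stage13HParams.Provisos₁₃SepCoPH.pinX3H` (instance of dag-n10-d's `Provisos₁₃SepCoPH.rebindX`), `datumOfRecord₁₃SepCoPH_pinX3H` (UP-SIDE); §2b ★
`socket05S_toStage5₁₃CoPH_pinX3H_iff` (`b8 ↔ B8LeafOfRecordSubBH θ₃ lam8`, `Iff.rfl`), `socket05_toStage5₁₃CoPH_pinX3H_iff` (the C-binding's typed leaf, `Iff.rfl`),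
`b8S_of_b8_toStage5₁₃CoPH_pinX3H` (typed ⇒ surviving, never conversely), `upOfRecord₅CS_toStage5₁₃CoPH_pinX3H_offB8` (`rfl` ×5); §3 `isRecordOfRecord₁₃CSepCoPH_pinX3H_of_eq`,
`exists_world_isRecordOfRecord₁₃CSepCoPH_pinX3H` (instances of dag-n10-d's generic re-binding records).
HONEST FRAMING: kernel bookkeeping; NO estimate; nothing of Bałaban's asserted; whether the surviving N05 socket is SERVED is the knits' ∕ providers' business (it is this
seat's knits' conclusion modulo THEIR displayed hypotheses; the typed one is NOT claimed); N05 NOT discharged; K1 NOT claimed; counts unmoved; one finite T⁴ programme at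
fixed ε — NOT continuum ∕ ℝ⁴ ∕ OS ∕ mass gap ∕ Clay.  No `sorry`, no `axiom`, no `instance`, no `notation`.
[Balaban1985RegularSpaces] = Commun. Math. Phys. **99** (1985) 75–102; [Balaban1989LargeFieldII] = Commun. Math. Phys. **122** (1989) 355–392; [Balaban1988Convergent] = Commun.
Math. Phys. **119** (1988) 243–285; [Balaban1987RG1] = Commun. Math. Phys. **109** (1987) 249–301; [Balaban1988RG2Cluster] = Commun. Math. Phys. **116** (1988) 1–22.
-/

noncomputable section

namespace Literature.MathematicalPhysics.QuantumFieldTheory.Balaban1983to89.Node00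

open T4Continuum AveragingRT FlowStep FlowStepRuns DagBinding T4DatumAssembly
open B8IdxB8LawsB (IdxB8SubB famB8OfRecordSubB)
open scoped Matrix.Norms.L2Operator

variable (F : T4Family) (N : ℕ) [NeZero N]

/-! ## §0 (H). FACES OF THE H-LEVEL H-PIN BY NAME — nothing declared: dag-n10-d's `Stage13HParams.pinX3H θ lam8 lam12 lam13 := θ.rebindX F N (XPinned₁₃H F N θ.toStage13Params …)`
(`Record13CarriersCoPH` §0, p539476) has its Stage-13 part `= θ.toStage13Params.pinX3H …` and its v1.6 part `= θ.toStage13RParams.pinX3H …` (`Stage13HParams.pins_toStage13Params ∕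
pins_toStage13RParams`, `rfl`), so the single-name faces `Stage13RParams.pinX3H_res_X ∕ _toStage12Params ∕ _histories`, `WOfRecord₁₃_pinX3H_R` (this seat's v1.6 `Record13CarriersXPinnedHCoPR` §0,
p532917) apply at `θ.toStage13RParams` and the θ-level faces `Stage13Params.pinX3H_S13 ∕ _c13 ∕ _F12 ∕ _c12 ∕ _toStage3Params ∕ _L_γ ∕ _ε₂₉ ∕ _res_Y_Z_W`, `F12OfRecord₁₂_pinX3H`
(`Record13CarriersXPinnedH` §1) at `θ.toStage13Params` — VERBATIM (the gate's dedup reads H-instances as restatements: cited, not re-declared); `res.X` generically by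
`Stage13HParams.rebindX_faces`; never a direct `rfl` at the pin -/

/-! ## §1b. The H-pin at the v1.7 key: laws, v1.7 separated-range provisos and datum (instances of dag-n10-d's generic `…CoPH_rebindX` faces; the v1.7 view ∕ core provisos ∕ core datum ∕ core record at the H-pin are dag-n10-d's `Record13CarriersCoPH`, cited) -/

section PinX3HCoPH

variable (θ : Stage13HParams F N) (lam8 : ResidB8 θ.toStage3Params) (lam12 : ResidB12 F N θ.τ9.M)
  (lam13 : B12.RunParams → ResidB13 θ.toStage3Params)

/-- The two background-reading laws at the H-pinned parameter are `θ`'s (`SLaw₁₃CoPH_TLaw₁₃CoPH_rebindX`). [cite: Balaban1988Convergent, (2.18) p.257 (bookkeeping)] -/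
theorem Stage13HParams.pinX3H_lawsCoPH :
    SLaw₁₃CoPH F N (θ.pinX3H F N lam8 lam12 lam13) = SLaw₁₃CoPH F N θ ∧ TLaw₁₃CoPH F N (θ.pinX3H F N lam8 lam12 lam13) = TLaw₁₃CoPH F N θ :=
  SLaw₁₃CoPH_TLaw₁₃CoPH_rebindX F N θ _

variable {F N θ} in
/-- The v1.7 provisos transport along the H-pin (`Provisos₁₃SepCoPH.rebindX`, dag-n10-d). [cite: Balaban1988Convergent, (2.23)–(2.42) pp.259–262; Balaban1985RegularSpaces, (1.3)–(1.9) pp.76–77 (bookkeeping)] -/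
theorem Stage13HParams.Provisos₁₃SepCoPH.pinX3H (h : θ.Provisos₁₃SepCoPH F N) : (θ.pinX3H F N lam8 lam12 lam13).Provisos₁₃SepCoPH F N :=
  h.rebindX _

/-- UP-SIDE (v1.7 separated range): the datum of record is `θ`'s (`datumOfRecord₁₃SepCoPH_rebindX`). [cite: Balaban1989LargeFieldII, Thm 1 + (0.1) pp.355–356 (bookkeeping)] -/
theorem datumOfRecord₁₃SepCoPH_pinX3H (h : θ.Provisos₁₃SepCoPH F N) :
    datumOfRecord₁₃SepCoPH F N (θ.pinX3H F N lam8 lam12 lam13) (h.pinX3H lam8 lam12 lam13) = datumOfRecord₁₃SepCoPH F N θ h :=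
  datumOfRecord₁₃SepCoPH_rebindX F N θ h _ _

end PinX3HCoPH
/-! ## §2b. N05's SURVIVING socket at the H-pinned v1.7 view (the S-binding `upOfRecord₅CS`) = the REPAIRED SLOT the knits of record serve -/

section SocketS

variable (θ : Stage13HParams F N) (lam8 : ResidB8 θ.toStage3Params) (lam12 : ResidB12 F N θ.τ9.M)
  (lam13 : B12.RunParams → ResidB13 θ.toStage3Params) (P : B12.RunParams)

/-- ★ **THE `b8` LEAF OF THE S-BINDING OVER THE H-PINNED v1.7 VIEW IS THE REPAIRED SLOT `B8LeafOfRecordSubBH θ₃ lam8`** (`Iff.rfl`) — the conclusion shape of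
`Summits/…/BalabanUVNodesN05SubBHKnitUniv(T8Srv)` at `lam8 := λ.cutSubB J (zdLan ∘ ι) c₁`; no kernel refutation applies (cf. `BalabanUVNodesN05XPinVacuity` for the un-repaired pin).
[cite: Balaban1985RegularSpaces, Lemma 1 – Thm 8 pp.79–101, Thm 8 (1.146) p.101 (the surviving leaf at the repaired objects of record)] -/
theorem socket05S_toStage5₁₃CoPH_pinX3H_iff :
    (upOfRecord₅CS F N ((θ.pinX3H F N lam8 lam12 lam13).toStage5₁₃CoPH F N) P).b8 ↔ B8LeafOfRecordSubBH θ.toStage3Params lam8 :=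
  Iff.rfl

/-- The C-binding's `b8` over the H-pinned v1.7 view is the TYPED [B8″] leaf over the repaired members (`Iff.rfl`; = `socket05_pinX3H_iff`'s reading at that view).
[cite: Balaban1985RegularSpaces, Lemma 1 – Thm 8 pp.79–101 (bookkeeping)] -/
theorem socket05_toStage5₁₃CoPH_pinX3H_iff :
    (upOfRecord₅C F N ((θ.pinX3H F N lam8 lam12 lam13).toStage5₁₃CoPH F N) P).b8 ↔
      B8LeafR θ.D (θ.L : ℝ) lam8.C₂ lam8.B₁' lam8.inp.B₀' lam8.B₁ lam8.B₂ lam8.c₁ lam8.inp lam8.B₀β (B8Lemma1NonAbelian.blockPairNA θ.D θ.L θ.𝔸)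
        (fun j : IdxB8SubB θ.toStage3Params => famB8OfRecordSubBH θ.toStage3Params lam8.β lam8.len j) lam8.lan lam8.cub (fun j => lam8.toAxial j.1) :=
  Iff.rfl

/-- TYPED ⇒ SURVIVING at the H-pinned view (`b8LeafOfRecordSubBH_of_b8LeafR`): the C-binding's `b8` implies the S-binding's. [cite: Balaban1985RegularSpaces, Thm 8 p.101, (1.36) p.82, (1.62) p.87 (bookkeeping)] -/
theorem b8S_of_b8_toStage5₁₃CoPH_pinX3H (h : (upOfRecord₅C F N ((θ.pinX3H F N lam8 lam12 lam13).toStage5₁₃CoPH F N) P).b8) :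
    (upOfRecord₅CS F N ((θ.pinX3H F N lam8 lam12 lam13).toStage5₁₃CoPH F N) P).b8 :=
  b8LeafOfRecordSubBH_of_b8LeafR (θ := θ.toStage3Params) lam8 h

/-- The other leaves of the S-binding over the H-pinned v1.7 view are the C-binding's (`rfl` ×5). [cite: Balaban1989LargeFieldII, Thm 1 p.355 (bookkeeping)] -/
theorem upOfRecord₅CS_toStage5₁₃CoPH_pinX3H_offB8 :
    (upOfRecord₅CS F N ((θ.pinX3H F N lam8 lam12 lam13).toStage5₁₃CoPH F N) P).b9 = (upOfRecord₅C F N ((θ.pinX3H F N lam8 lam12 lam13).toStage5₁₃CoPH F N) P).b9 ∧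
    (upOfRecord₅CS F N ((θ.pinX3H F N lam8 lam12 lam13).toStage5₁₃CoPH F N) P).b10 = (upOfRecord₅C F N ((θ.pinX3H F N lam8 lam12 lam13).toStage5₁₃CoPH F N) P).b10 ∧
    (upOfRecord₅CS F N ((θ.pinX3H F N lam8 lam12 lam13).toStage5₁₃CoPH F N) P).b11 = (upOfRecord₅C F N ((θ.pinX3H F N lam8 lam12 lam13).toStage5₁₃CoPH F N) P).b11 ∧
    (upOfRecord₅CS F N ((θ.pinX3H F N lam8 lam12 lam13).toStage5₁₃CoPH F N) P).b12 = (upOfRecord₅C F N ((θ.pinX3H F N lam8 lam12 lam13).toStage5₁₃CoPH F N) P).b12 ∧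
    (upOfRecord₅CS F N ((θ.pinX3H F N lam8 lam12 lam13).toStage5₁₃CoPH F N) P).rBasicStep =
      (upOfRecord₅C F N ((θ.pinX3H F N lam8 lam12 lam13).toStage5₁₃CoPH F N) P).rBasicStep :=
  ⟨rfl, rfl, rfl, rfl, rfl⟩

end SocketS

/-! ## §3. The v1.7 records presented at the H-pinned parameter (instances of dag-n10-d's generic re-binding records) -/

section Records

variable {F N}

/-- … and a v1.7 separated-range record (`isRecordOfRecord₁₃CSepCoPH_rebindX_of_eq`). [cite: Balaban1989LargeFieldII, Thm 1 + (0.1) pp.355–356 (bookkeeping)] -/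
theorem isRecordOfRecord₁₃CSepCoPH_pinX3H_of_eq (θ : Stage13HParams F N) (h : θ.Provisos₁₃SepCoPH F N) (hθ : θ.Admissible F N) (lam8 : ResidB8 θ.toStage3Params)
    (lam12 : ResidB12 F N θ.τ9.M) (lam13 : B12.RunParams → ResidB13 θ.toStage3Params) (w : WorldP) (hC : w.C = (datumOfRecord₁₃SepCoPH F N θ h).C)
    (hγ : 0 < w.γ ∧ w.γ ≤ θ.γ) (hL : w.L = (θ.L : ℝ)) (hup : ∀ P, w.up P = upOfRecord₅C F N ((θ.pinX3H F N lam8 lam12 lam13).toStage5₁₃CoPH F N) P) :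
    IsRecordOfRecord₁₃CSepCoPH F N (datumOfRecord₁₃SepCoPH F N θ h) w :=
  isRecordOfRecord₁₃CSepCoPH_rebindX_of_eq F N θ h hθ _ w hC hγ hL hup

/-- Every admissible Stage-13 parameter with the v1.7 provisos presents a v1.7 record of its own datum over the H-pinned v1.7 view, any window, block size `θ.L`
(`exists_world_isRecordOfRecord₁₃CSepCoPH_rebindX`). [cite: Balaban1989LargeFieldII, Thm 1 + (0.1) pp.355–356 (bookkeeping)] -/
theorem exists_world_isRecordOfRecord₁₃CSepCoPH_pinX3H (θ : Stage13HParams F N) (h : θ.Provisos₁₃SepCoPH F N) (hθ : θ.Admissible F N)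
    (lam8 : ResidB8 θ.toStage3Params) (lam12 : ResidB12 F N θ.τ9.M) (lam13 : B12.RunParams → ResidB13 θ.toStage3Params) {γw : ℝ} (hγw : 0 < γw ∧ γw ≤ θ.γ) :
    ∃ w : WorldP, IsRecordOfRecord₁₃CSepCoPH F N (datumOfRecord₁₃SepCoPH F N θ h) w ∧ w.γ = γw ∧ w.L = (θ.L : ℝ) ∧
      ∀ P, w.up P = upOfRecord₅C F N ((θ.pinX3H F N lam8 lam12 lam13).toStage5₁₃CoPH F N) P :=
  exists_world_isRecordOfRecord₁₃CSepCoPH_rebindX F N θ h hθ _ hγw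

end Records

#print axioms socket05S_toStage5₁₃CoPH_pinX3H_iff
#print axioms isRecordOfRecord₁₃CSepCoPH_pinX3H_of_eq

end Literature.MathematicalPhysics.QuantumFieldTheory.Balaban1983to89.Node00

end
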